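import Literature.NumberTheory.LFunctions.ExplicitFormulaPsiOne
import Literature.Analysis.SpecialFunctions.DigammaVerticalAsymptotics
import HarnessLib

/-!
# `ζ'/ζ(−1/2 + it) = −log(|t| + 2) + O(1)`

Trunk T-ANT (`Literature/NumberTheory/LFunctions`). Proofs only. The secondary term of Montgomery's
explicit formula (P1) `montgomery_explicit_formula` (Goldston 2005, Proposition 1 (3.11):
`… + x^{−1/2}(log(|t|+2) + O(1)) + …`) comes from `−ζ'/ζ(−1/2 + it)`, and Goldston's proof uses
"`ζ'/ζ(−1/2 + it) = −log(|t|+2) + O(1)`, which follows easily from the functional equation". The tree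
has the one-sided bound `PsiOneExplicit.exists_norm_logDeriv_riemannZeta_left_le`
(`|ζ'/ζ(−1/2+it)| ≤ C + 2 log(1+|t|)`, `ExplicitFormulaPsiOne.lean`); here the two-sided asymptotic:

* `Montgomery.exists_norm_logDeriv_riemannZeta_left_add_log_le` :
  `‖ζ'/ζ(−1/2 + it) + log(|t| + 2)‖ ≤ C` for all real `t`.

Proof: `ζ'/ζ(s) = ξ'/ξ(s) − 1/s − 1/(s−1) − Γ_ℝ'/Γ_ℝ(s)` at `s` and at `1 − s = 3/2 − it`
(`PsiOneExplicit.logDeriv_riemannZeta_eq_logDeriv_riemannXi`) and `ξ'/ξ(s) = −ξ'/ξ(1 − s)`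
(`logDeriv_riemannXi_one_sub`) give `ζ'/ζ(s) = −ζ'/ζ(1−s) − Γ_ℝ'/Γ_ℝ(1−s) − Γ_ℝ'/Γ_ℝ(s)`; then
`Γ_ℝ'/Γ_ℝ(w) = −½ log π + ½ ψ(w/2 + 1) − 1/w` (`PsiOneExplicit.logDeriv_Gammaℝ_eq_shift`), the
two-sided digamma asymptotic `ψ(a + iy) = log(1 + |y|) + O_a(1)`
(`Literature/Analysis/SpecialFunctions/DigammaVerticalAsymptotics.lean`, at `a = 3/4, 7/4`,
`y = ±t/2`, `log(1 + |t|/2) = log(|t| + 2) − log 2`), and `|ζ'/ζ(3/2 − it)| ≤ ∑ Λ(n) n^{−3/2}`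
(`Montgomery.norm_logDeriv_riemannZeta_le_of_three_halves_le_re`).

## References

* D. A. Goldston, *Notes on pair correlation of zeros and prime numbers*, LMS Lecture Note Ser. 322
  (2005), proof of Proposition 1.
* H. L. Montgomery, *The pair correlation of zeros of the zeta function*, Proc. Sympos. Pure Math. 24
  (1973), 181–193, Lemma.
-/

noncomputable section

open Complex Filter Set LSeries
open scoped Real LSeries.notation ArithmeticFunction.vonMangoldt

namespace Literature.NumberTheory.LFunctions

namespace Montgomery

/-- `‖ζ'/ζ(s)‖ ≤ ∑ Λ(n) n^{−3/2}` for `Re s ≥ 3/2` (`−ζ'/ζ = ∑ Λ(n) n^{−s}` converges absolutely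
there). [folklore] -/
theorem norm_logDeriv_riemannZeta_le_of_three_halves_le_re {s : ℂ} (hs : 3 / 2 ≤ s.re) :
    ‖deriv riemannZeta s / riemannZeta s‖ ≤ ∑' n : ℕ, ‖term ↗Λ ((3 / 2 : ℝ) : ℂ) n‖ := by
  have hs1 : 1 < s.re := by linarith
  have hL := ArithmeticFunction.LSeries_vonMangoldt_eq_deriv_riemannZeta_div hs1
  have heq : deriv riemannZeta s / riemannZeta s = -L ↗Λ s := by rw [hL]; ring
  have hsum2 : Summable fun n ↦ ‖term ↗Λ ((3 / 2 : ℝ) : ℂ) n‖ :=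
    summable_norm_iff.mpr (ArithmeticFunction.LSeriesSummable_vonMangoldt (s := ((3 / 2 : ℝ) : ℂ))
      (by simp; norm_num))
  have hterm : ∀ n, ‖term ↗Λ s n‖ ≤ ‖term ↗Λ ((3 / 2 : ℝ) : ℂ) n‖ :=
    fun n ↦ norm_term_le_of_re_le_re _ (by simpa using hs) n
  have hsum : Summable fun n ↦ ‖term ↗Λ s n‖ := hsum2.of_nonneg_of_le (fun n ↦ norm_nonneg _) hterm
  rw [heq, norm_neg]
  calc ‖L ↗Λ s‖ = ‖∑' n, term ↗Λ s n‖ := rfl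
    _ ≤ ∑' n, ‖term ↗Λ s n‖ := norm_tsum_le_tsum_norm hsum
    _ ≤ ∑' n, ‖term ↗Λ ((3 / 2 : ℝ) : ℂ) n‖ := hsum.tsum_le_tsum hterm hsum2

/-- **`ζ'/ζ(−1/2 + it) = −log(|t| + 2) + O(1)`** (Goldston 2005, proof of Proposition 1: "which
follows easily from the functional equation"; Montgomery 1973, Lemma). Proof: for `s = −1/2 + it`,
`ζ'/ζ(s) = ξ'/ξ(s) − 1/s − 1/(s−1) − Γ_ℝ'/Γ_ℝ(s)` (`PsiOneExplicit.logDeriv_riemannZeta_eq_logDeriv_riemannXi`),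
`ξ'/ξ(s) = −ξ'/ξ(1−s)` (`logDeriv_riemannXi_one_sub`) and the same identity at `1 − s = 3/2 − it`
give `ζ'/ζ(s) = −ζ'/ζ(1−s) − Γ_ℝ'/Γ_ℝ(1−s) − Γ_ℝ'/Γ_ℝ(s)`; then
`Γ_ℝ'/Γ_ℝ(w) = −½ log π + ½ ψ(w/2 + 1) − 1/w` (`PsiOneExplicit.logDeriv_Gammaℝ_eq_shift`) and
`ψ(a + iy) = log(1 + |y|) + O(1)` (`exists_norm_digamma_sub_log_le_of_pos`, at `a = 3/4, 7/4`,
`y = ±t/2`), with `ζ'/ζ(3/2 − it) = O(1)`. [cite: Goldston2005, proof of Proposition 1] -/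
theorem exists_norm_logDeriv_riemannZeta_left_add_log_le :
    ∃ C : ℝ, ∀ t : ℝ,
      ‖deriv riemannZeta (((-(1 / 2) : ℝ) : ℂ) + t * I) / riemannZeta (((-(1 / 2) : ℝ) : ℂ) + t * I) +
        Real.log (|t| + 2)‖ ≤ C := by
  obtain ⟨C₁, hC₁⟩ := Literature.Analysis.SpecialFunctions.Complex.exists_norm_digamma_sub_log_le_of_pos
    (by norm_num : (0 : ℝ) < 3 / 4)
  obtain ⟨C₂, hC₂⟩ := Literature.Analysis.SpecialFunctions.Complex.exists_norm_digamma_sub_log_le_of_pos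
    (by norm_num : (0 : ℝ) < 7 / 4)
  set Cζ : ℝ := ∑' n : ℕ, ‖term ↗Λ ((3 / 2 : ℝ) : ℂ) n‖ with hCζ
  refine ⟨Cζ + Real.log π + Real.log 2 + (C₁ + C₂) / 2 + 3, fun t ↦ ?_⟩
  set s : ℂ := ((-(1 / 2) : ℝ) : ℂ) + t * I with hs
  set s' : ℂ := ((3 / 2 : ℝ) : ℂ) + (-t) * I with hs'
  have hss' : s' = 1 - s := by
    rw [hs, hs']; apply Complex.ext
    · simp; norm_num
    · simp
  have hsre : s.re = -(1 / 2) := by simp [hs]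
  have hs're : s'.re = 3 / 2 := by simp [hs']
  have h0 : s ≠ 0 := fun h ↦ by have := congrArg Complex.re h; rw [hsre] at this; norm_num at this
  have h1 : s ≠ 1 := fun h ↦ by have := congrArg Complex.re h; rw [hsre] at this; norm_num at this
  have h0' : s' ≠ 0 := fun h ↦ by have := congrArg Complex.re h; rw [hs're] at this; norm_num at this
  have h1' : s' ≠ 1 := fun h ↦ by have := congrArg Complex.re h; rw [hs're] at this; norm_num at this
  have hζ : riemannZeta s ≠ 0 := PsiOneExplicit.riemannZeta_left_ne_zero t
  have hζ' : riemannZeta s' ≠ 0 := riemannZeta_ne_zero_of_one_lt_re (by rw [hs're]; norm_num)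
  -- the two identities `ζ'/ζ = ξ'/ξ − 1/w − 1/(w−1) − Γ_ℝ'/Γ_ℝ` and the functional equation
  have e1 := PsiOneExplicit.logDeriv_riemannZeta_eq_logDeriv_riemannXi (by rw [hsre]; norm_num) h0 h1 hζ
  have e2 := PsiOneExplicit.logDeriv_riemannZeta_eq_logDeriv_riemannXi (by rw [hs're]; norm_num) h0' h1' hζ'
  have eFE : logDeriv riemannXi s = -logDeriv riemannXi s' := by
    rw [hss', ← logDeriv_riemannXi_one_sub (1 - s), sub_sub_cancel]
  have hs1 : s - 1 ≠ 0 := sub_ne_zero.2 h1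
  have h1s0 : (1 : ℂ) - s ≠ 0 := sub_ne_zero.2 (Ne.symm h1)
  have r1 : 1 / s' = -(1 / (s - 1)) := by
    rw [hss']; field_simp; ring
  have r2 : 1 / (s' - 1) = -(1 / s) := by
    rw [hss', show (1 : ℂ) - s - 1 = -s by ring, one_div_neg_eq_neg_one_div]
  have key : deriv riemannZeta s / riemannZeta s =
      -(deriv riemannZeta s' / riemannZeta s') - logDeriv Gammaℝ s' - logDeriv Gammaℝ s := by
    rw [e1, e2, eFE, r1, r2]
    ring
  -- the Gamma factors through `ψ`
  have hΓ := PsiOneExplicit.logDeriv_Gammaℝ_eq_shift (s := s) (by rw [hsre]; norm_num) h0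
  have hΓ' := PsiOneExplicit.logDeriv_Gammaℝ_eq_shift (s := s') (by rw [hs're]; norm_num) h0'
  have ew : s / 2 + 1 = ((3 / 4 : ℝ) : ℂ) + (t / 2 : ℝ) * I := by rw [hs]; push_cast; ring
  have ew' : s' / 2 + 1 = ((7 / 4 : ℝ) : ℂ) + (-(t / 2) : ℝ) * I := by rw [hs']; push_cast; ring
  have hψ := hC₁ (t / 2)
  have hψ' := hC₂ (-(t / 2))
  rw [abs_neg] at hψ'
  -- `log(1 + |t/2|) = log(|t| + 2) − log 2`
  have hlog : Real.log (1 + |t / 2|) = Real.log (|t| + 2) - Real.log 2 := by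
    rw [abs_div, abs_two, show 1 + |t| / 2 = (|t| + 2) / 2 by ring,
      Real.log_div (by positivity) (by norm_num)]
  rw [hlog] at hψ hψ'
  -- bounded rational pieces
  have hns : (1 / 2 : ℝ) ≤ ‖s‖ := by
    have := Complex.abs_re_le_norm s; rw [hsre] at this; norm_num at this; exact this
  have hns' : (3 / 2 : ℝ) ≤ ‖s'‖ := by
    have := Complex.abs_re_le_norm s'; rw [hs're] at this; norm_num at this; exact this
  have h1s : ‖1 / s‖ ≤ 2 := by
    rw [norm_div, norm_one, div_le_iff₀ (by linarith)]; linarith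
  have h1s' : ‖1 / s'‖ ≤ 1 := by
    rw [norm_div, norm_one, div_le_iff₀ (by linarith)]; linarith
  have hζb : ‖deriv riemannZeta s' / riemannZeta s'‖ ≤ Cζ :=
    norm_logDeriv_riemannZeta_le_of_three_halves_le_re (by rw [hs're])
  -- assemble: the target is a sum of bounded pieces
  have etot : deriv riemannZeta s / riemannZeta s + Real.log (|t| + 2) =
      -(deriv riemannZeta s' / riemannZeta s') + (Complex.log π) + 1 / s' + 1 / s
        + ((Real.log 2 : ℝ) : ℂ)
        - (digamma (((7 / 4 : ℝ) : ℂ) + (-(t / 2) : ℝ) * I) - ((Real.log (|t| + 2) - Real.log 2 : ℝ) : ℂ)) / 2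
        - (digamma (((3 / 4 : ℝ) : ℂ) + (t / 2 : ℝ) * I) - ((Real.log (|t| + 2) - Real.log 2 : ℝ) : ℂ)) / 2 := by
    rw [key, hΓ, hΓ', ew, ew']
    push_cast
    ring
  rw [etot]
  have hlogπ : ‖Complex.log π‖ = Real.log π := by
    rw [← Complex.ofReal_log Real.pi_pos.le, Complex.norm_real, Real.norm_eq_abs,
      abs_of_pos (Real.log_pos (by linarith [Real.pi_gt_three]))]
  have hlog2 : ‖((Real.log 2 : ℝ) : ℂ)‖ = Real.log 2 := by
    rw [Complex.norm_real, Real.norm_eq_abs, abs_of_nonneg (Real.log_nonneg (by norm_num))]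
  have hd1 : ‖(digamma (((7 / 4 : ℝ) : ℂ) + (-(t / 2) : ℝ) * I) -
      ((Real.log (|t| + 2) - Real.log 2 : ℝ) : ℂ)) / 2‖ ≤ C₂ / 2 := by
    rw [norm_div, Complex.norm_two]; linarith
  have hd2 : ‖(digamma (((3 / 4 : ℝ) : ℂ) + (t / 2 : ℝ) * I) -
      ((Real.log (|t| + 2) - Real.log 2 : ℝ) : ℂ)) / 2‖ ≤ C₁ / 2 := by
    rw [norm_div, Complex.norm_two]; linarith
  calc _ ≤ ‖-(deriv riemannZeta s' / riemannZeta s') + Complex.log π + 1 / s' + 1 / s + ((Real.log 2 : ℝ) : ℂ)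
          - (digamma (((7 / 4 : ℝ) : ℂ) + (-(t / 2) : ℝ) * I) - ((Real.log (|t| + 2) - Real.log 2 : ℝ) : ℂ)) / 2‖
        + ‖(digamma (((3 / 4 : ℝ) : ℂ) + (t / 2 : ℝ) * I) - ((Real.log (|t| + 2) - Real.log 2 : ℝ) : ℂ)) / 2‖ :=
        norm_sub_le _ _
    _ ≤ (‖-(deriv riemannZeta s' / riemannZeta s') + Complex.log π + 1 / s' + 1 / s + ((Real.log 2 : ℝ) : ℂ)‖
          + ‖(digamma (((7 / 4 : ℝ) : ℂ) + (-(t / 2) : ℝ) * I) - ((Real.log (|t| + 2) - Real.log 2 : ℝ) : ℂ)) / 2‖)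
        + C₁ / 2 := by gcongr; exact norm_sub_le _ _
    _ ≤ ((‖-(deriv riemannZeta s' / riemannZeta s') + Complex.log π + 1 / s' + 1 / s‖ + ‖((Real.log 2 : ℝ) : ℂ)‖)
          + C₂ / 2) + C₁ / 2 := by gcongr; exact norm_add_le _ _
    _ ≤ (((‖-(deriv riemannZeta s' / riemannZeta s') + Complex.log π + 1 / s'‖ + ‖1 / s‖) + Real.log 2)
          + C₂ / 2) + C₁ / 2 := by rw [hlog2]; gcongr; exact norm_add_le _ _
    _ ≤ ((((‖-(deriv riemannZeta s' / riemannZeta s') + Complex.log π‖ + ‖1 / s'‖) + 2) + Real.log 2)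
          + C₂ / 2) + C₁ / 2 := by gcongr; exact norm_add_le _ _
    _ ≤ (((((‖-(deriv riemannZeta s' / riemannZeta s')‖ + ‖Complex.log π‖) + 1) + 2) + Real.log 2)
          + C₂ / 2) + C₁ / 2 := by gcongr; exact norm_add_le _ _
    _ ≤ (((((Cζ + Real.log π) + 1) + 2) + Real.log 2) + C₂ / 2) + C₁ / 2 := by
        rw [norm_neg, hlogπ]; gcongr
    _ = Cζ + Real.log π + Real.log 2 + (C₁ + C₂) / 2 + 3 := by ring

end Montgomery

end Literature.NumberTheory.LFunctions
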